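import Mathlib

/-!
# Laplacian calculus on `ℝ[X₀,X₁,X₂]` and the harmonic projection

Support file for item `DilutionTransfer` (stmt-CriticalPhenomena-6037) of route
`HarmonicMomentsIsotropy` (sub-problem `Ising3DConformalLimit`).

Pure algebra in `MvPolynomial (Fin 3) ℝ`: with `rsq = X₀² + X₁² + X₂²` and the Laplacian
`lap = ∑ᵢ ∂ᵢ²`,
* `lap_rsq_pow_succ_mul` — `Δ(|y|^{2(j+1)} F) = 2(j+1)(2j+3+2m)|y|^{2j}F + |y|^{2(j+1)} ΔF` for `F`
  homogeneous of degree `m` (Euler's identity);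
* `harmProj` — the explicit harmonic projection `Π P = ∑ⱼ cⱼ |y|^{2j} Δʲ P` of a homogeneous `P`,
  `lap_harmProj`, `harmProj_add_rsq_mul`;
* `lap_iterate_rsq_pow_mul_harmonic` — `Δⁱ(|y|^{2j} H)` for harmonic `H`;
* `linForm` — the linear form `L_ξ = ∑ ξᵢ Xᵢ` and its derivatives.
The Fischer decomposition itself is in `HarmonicMomentsIsotropyDilutionTransferFischer`.

References: E. M. Stein, G. Weiss, *Introduction to Fourier analysis on Euclidean spaces* (1971),
Ch. IV §2 (the decomposition `P = ∑ |x|^{2j} H_j`); S. Axler, P. Bourdon, W. Ramey, *Harmonic Function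
Theory*, Thm. 5.7. Everything here is elementary and self-contained.
-/

noncomputable section

open MvPolynomial Finset

namespace Summit.CriticalPhenomena.Ising3DConformalLimit.Theorems.HarmonicMomentsIsotropy.Fischer

/-- Real polynomials in three variables. -/
abbrev Poly : Type := MvPolynomial (Fin 3) ℝ

/-- The squared radius `|y|² = X₀² + X₁² + X₂²`. -/
def rsq : Poly := ∑ i : Fin 3, X i ^ 2

/-- The `i`-th partial derivative as an `ℝ`-linear map. -/
def pd (i : Fin 3) : Poly →ₗ[ℝ] Poly := (pderiv i : Derivation ℝ Poly Poly).toLinearMap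

/-- `pd i P = ∂ᵢ P`. -/
@[simp] theorem pd_apply (i : Fin 3) (P : Poly) : pd i P = pderiv i P := rfl

/-- The Laplacian `Δ = ∑ᵢ ∂ᵢ ∂ᵢ` as a linear map. -/
def lap : Poly →ₗ[ℝ] Poly := ∑ i : Fin 3, (pd i).comp (pd i)

/-- `Δ P = ∑ᵢ ∂ᵢ(∂ᵢ P)`. -/
theorem lap_apply (P : Poly) : lap P = ∑ i : Fin 3, pderiv i (pderiv i P) := by
  simp [lap]

/-- `rsq` is homogeneous of degree `2`. -/
theorem rsq_isHomogeneous : (rsq).IsHomogeneous 2 := by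
  unfold rsq
  refine IsHomogeneous.sum _ _ _ fun i _ => ?_
  simpa using (isHomogeneous_X ℝ i).pow 2

/-- `∂ᵢ |y|² = 2 Xᵢ`. -/
theorem pderiv_rsq (i : Fin 3) : pderiv i rsq = 2 * X i := by
  classical
  unfold rsq
  rw [map_sum]
  have : ∀ j : Fin 3, pderiv i ((X j : Poly) ^ 2) = if j = i then 2 * X i else 0 := by
    intro j
    rw [pderiv_pow, pderiv_X]
    by_cases h : j = i
    · subst h; simp [Pi.single_eq_same]
    · simp [h]
  simp only [this, Finset.sum_ite_eq', Finset.mem_univ, if_true]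

/-- A homogeneous polynomial of degree `0` has vanishing partial derivatives. -/
theorem pderiv_eq_zero_of_isHomogeneous_zero {F : Poly} (hF : F.IsHomogeneous 0) (i : Fin 3) :
    pderiv i F = 0 := by
  rw [← totalDegree_zero_iff_isHomogeneous, totalDegree_eq_zero_iff_eq_C] at hF
  rw [hF, pderiv_C]

/-- A homogeneous polynomial of degree `≤ 1` is harmonic. -/
theorem lap_eq_zero_of_isHomogeneous_le_one {F : Poly} {m : ℕ} (hF : F.IsHomogeneous m)
    (hm : m ≤ 1) : lap F = 0 := by
  rw [lap_apply]
  refine Finset.sum_eq_zero fun i _ => ?_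
  have h1 : (pderiv i F).IsHomogeneous (m - 1) := hF.pderiv
  have h0 : (pderiv i F).IsHomogeneous 0 := by
    have : m - 1 = 0 := by omega
    rwa [this] at h1
  exact pderiv_eq_zero_of_isHomogeneous_zero h0 i

/-- `Δ 1 = 0`. -/
theorem lap_one : lap (1 : Poly) = 0 :=
  lap_eq_zero_of_isHomogeneous_le_one (isHomogeneous_one (Fin 3) ℝ) (by norm_num)

/-- `Δ (C a) = 0`. -/
theorem lap_C (a : ℝ) : lap (C a : Poly) = 0 :=
  lap_eq_zero_of_isHomogeneous_le_one (isHomogeneous_C (Fin 3) a) (by norm_num)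

/-- `Δ` lowers the degree of a homogeneous polynomial by two. -/
theorem isHomogeneous_lap {F : Poly} {m : ℕ} (hF : F.IsHomogeneous m) :
    (lap F).IsHomogeneous (m - 2) := by
  rw [lap_apply]
  refine IsHomogeneous.sum _ _ _ fun i _ => ?_
  have := (hF.pderiv (i := i)).pderiv (i := i)
  have e : m - 1 - 1 = m - 2 := by omega
  rwa [e] at this

/-- Iterated Laplacians of a homogeneous polynomial are homogeneous. -/
theorem isHomogeneous_lap_iterate {P : Poly} {k : ℕ} (hP : P.IsHomogeneous k) (j : ℕ) :
    (lap^[j] P).IsHomogeneous (k - 2 * j) := by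
  induction j with
  | zero => simpa using hP
  | succ j ih =>
    rw [Function.iterate_succ_apply']
    have := isHomogeneous_lap ih
    have e : k - 2 * j - 2 = k - 2 * (j + 1) := by omega
    rwa [e] at this

/-- `Δʲ P = 0` once `2j` exceeds the degree of the homogeneous `P`. -/
theorem lap_iterate_eq_zero {P : Poly} {k j : ℕ} (hP : P.IsHomogeneous k) (hj : k < 2 * j) :
    lap^[j] P = 0 := by
  obtain ⟨j, rfl⟩ : ∃ j', j = j' + 1 := ⟨j - 1, by omega⟩
  rw [Function.iterate_succ_apply']
  exact lap_eq_zero_of_isHomogeneous_le_one (isHomogeneous_lap_iterate hP j) (by omega)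

/-- **`Δ(|y|² F)`** for `F` homogeneous of degree `m`: `(6 + 4m) F + |y|² ΔF` (Euler's identity). -/
theorem lap_rsq_mul {F : Poly} {m : ℕ} (hF : F.IsHomogeneous m) :
    lap (rsq * F) = (6 + 4 * (m : Poly)) * F + rsq * lap F := by
  have heuler : ∑ i : Fin 3, (X i : Poly) * pderiv i F = m • F := hF.sum_X_mul_pderiv
  have hterm : ∀ i : Fin 3, pderiv i (pderiv i (rsq * F)) =
      2 * F + 4 * (X i * pderiv i F) + rsq * pderiv i (pderiv i F) := by
    intro i
    rw [pderiv_mul, pderiv_rsq, map_add, pderiv_mul, pderiv_mul, pderiv_mul, pderiv_rsq,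
      pderiv_X_self]
    have h2 : pderiv i (2 : Poly) = 0 := by
      rw [show (2 : Poly) = C 2 from (map_ofNat C 2).symm, pderiv_C]
    rw [h2]
    ring
  have hsum : ∑ i : Fin 3, pderiv i (pderiv i (rsq * F)) =
      ∑ _i : Fin 3, (2 * F) + 4 * ∑ i : Fin 3, X i * pderiv i F +
        rsq * ∑ i : Fin 3, pderiv i (pderiv i F) := by
    rw [Finset.mul_sum, Finset.mul_sum, ← Finset.sum_add_distrib, ← Finset.sum_add_distrib]
    exact Finset.sum_congr rfl fun i _ => by rw [hterm i]
  rw [lap_apply, hsum, heuler, ← lap_apply]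
  simp only [Finset.sum_const, Finset.card_univ, Fintype.card_fin, nsmul_eq_mul]
  push_cast
  ring

/-- **`Δ(|y|^{2(j+1)} F)`** for `F` homogeneous of degree `m`:
`2(j+1)(2j+3+2m) |y|^{2j} F + |y|^{2(j+1)} ΔF`. -/
theorem lap_rsq_pow_succ_mul {F : Poly} {m : ℕ} (hF : F.IsHomogeneous m) (j : ℕ) :
    lap (rsq ^ (j + 1) * F) =
      (2 * ((j : Poly) + 1) * (2 * (j : Poly) + 3 + 2 * (m : Poly))) * (rsq ^ j * F) +
        rsq ^ (j + 1) * lap F := by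
  induction j with
  | zero =>
    rw [zero_add, pow_one, pow_zero, one_mul, lap_rsq_mul hF]
    simp only [CharP.cast_eq_zero]
    ring
  | succ j ih =>
    have hhom : (rsq ^ (j + 1) * F).IsHomogeneous (2 * (j + 1) + m) := by
      have := (rsq_isHomogeneous.pow (j + 1)).mul hF
      simpa [mul_comm] using this
    rw [pow_succ' rsq (j + 1), mul_assoc, lap_rsq_mul hhom, ih]
    push_cast
    ring

/-- Scalar form of `lap_rsq_pow_succ_mul`. -/
theorem lap_rsq_pow_succ_mul' {F : Poly} {m : ℕ} (hF : F.IsHomogeneous m) (j : ℕ) :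
    lap (rsq ^ (j + 1) * F) =
      ((2 : ℝ) * (j + 1) * (2 * j + 3 + 2 * m)) • (rsq ^ j * F) + rsq ^ (j + 1) * lap F := by
  rw [lap_rsq_pow_succ_mul hF j, smul_eq_C_mul]
  simp only [map_mul, map_add, map_natCast, map_ofNat, map_one]

/-- The positive constants `a(j, m) = 2(j+1)(2j+3+2m)` of `lap_rsq_pow_succ_mul'`. -/
def aCoef (j m : ℕ) : ℝ := 2 * (j + 1) * (2 * j + 3 + 2 * m)

/-- `a(j,m) > 0`. -/
theorem aCoef_pos (j m : ℕ) : 0 < aCoef j m := by unfold aCoef; positivity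

/-- Iterated Laplacian of `|y|^{2j} H` for `H` HARMONIC homogeneous of degree `m`, `i ≤ j`:
`Δⁱ(|y|^{2j} H) = (∏_{l<i} a(j-1-l, m)) |y|^{2(j-i)} H`. -/
theorem lap_iterate_rsq_pow_mul_harmonic {H : Poly} {m : ℕ} (hH : H.IsHomogeneous m)
    (hlap : lap H = 0) (j i : ℕ) (hij : i ≤ j) :
    lap^[i] (rsq ^ j * H) = (∏ l ∈ range i, aCoef (j - 1 - l) m) • (rsq ^ (j - i) * H) := by
  induction i with
  | zero => simp
  | succ i ih =>
    rw [Function.iterate_succ_apply', ih (by omega), map_smul, Finset.prod_range_succ]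
    obtain ⟨r, hr⟩ : ∃ r, j - i = r + 1 := ⟨j - i - 1, by omega⟩
    rw [hr, lap_rsq_pow_succ_mul' hH, hlap, mul_zero, add_zero, smul_smul]
    have e1 : j - (i + 1) = r := by omega
    have e2 : j - 1 - i = r := by omega
    rw [e1, e2, aCoef]

/-- For `H` harmonic homogeneous, `Δⁱ(|y|^{2j} H) = 0` when `j < i`. -/
theorem lap_iterate_rsq_pow_mul_harmonic_eq_zero {H : Poly} {m : ℕ} (hH : H.IsHomogeneous m)
    (hlap : lap H = 0) (j i : ℕ) (hij : j < i) : lap^[i] (rsq ^ j * H) = 0 := by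
  obtain ⟨r, rfl⟩ : ∃ r, i = r + (j + 1) := ⟨i - (j + 1), by omega⟩
  rw [Function.iterate_add_apply, Function.iterate_succ_apply',
    lap_iterate_rsq_pow_mul_harmonic hH hlap j j le_rfl, map_smul, Nat.sub_self, pow_zero,
    one_mul, hlap, smul_zero]
  exact Function.iterate_fixed (map_zero lap) r

/-- `Δʲ(|y|^{2j}) = γ · 1` with `γ ≠ 0`. -/
theorem lap_iterate_rsq_pow_self (j : ℕ) :
    ∃ γ : ℝ, γ ≠ 0 ∧ lap^[j] (rsq ^ j) = γ • (1 : Poly) := by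
  have h := lap_iterate_rsq_pow_mul_harmonic (isHomogeneous_one (Fin 3) ℝ) lap_one j j le_rfl
  rw [mul_one, Nat.sub_self, pow_zero, mul_one] at h
  refine ⟨_, ?_, h⟩
  exact Finset.prod_ne_zero_iff.2 fun l _ => (aCoef_pos _ _).ne'


/-- Iterates of `Δ` commute with scalars. -/
theorem lap_iterate_smul (j : ℕ) (c : ℝ) (P : Poly) : lap^[j] (c • P) = c • lap^[j] P := by
  induction j generalizing P with
  | zero => rfl
  | succ j ih => rw [Function.iterate_succ_apply, Function.iterate_succ_apply, map_smul, ih]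

/-- Iterates of `Δ` are additive. -/
theorem lap_iterate_add (j : ℕ) (P Q : Poly) : lap^[j] (P + Q) = lap^[j] P + lap^[j] Q := by
  induction j generalizing P Q with
  | zero => rfl
  | succ j ih => rw [Function.iterate_succ_apply, Function.iterate_succ_apply,
      Function.iterate_succ_apply, map_add, ih]

/-- Iterates of `Δ` commute with finite sums. -/
theorem lap_iterate_sum {ι : Type*} (s : Finset ι) (f : ι → Poly) (j : ℕ) :
    lap^[j] (∑ i ∈ s, f i) = ∑ i ∈ s, lap^[j] (f i) := by
  classical
  induction s using Finset.induction_on with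
  | empty => simp [Function.iterate_fixed (map_zero lap) j]
  | insert a s ha ih => rw [Finset.sum_insert ha, Finset.sum_insert ha, lap_iterate_add, ih]

/-! ## The harmonic projection of a homogeneous polynomial -/

/-- The coefficients `c₀ = 1`, `c_{j+1} = -c_j / a(j, k-2(j+1))` of the harmonic projection in
degree `k`. -/
def cP (k : ℕ) : ℕ → ℝ
  | 0 => 1
  | j + 1 => -cP k j / aCoef j (k - 2 * (j + 1))

/-- The defining recursion of `cP`: `c_{j+1} a(j, k-2(j+1)) + c_j = 0`. -/
theorem cP_succ_mul_aCoef (k j : ℕ) : cP k (j + 1) * aCoef j (k - 2 * (j + 1)) + cP k j = 0 := by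
  rw [cP, div_mul_cancel₀ _ (aCoef_pos _ _).ne']
  ring

/-- The harmonic projection `Π_k P = ∑_{j ≤ k/2} c_j |y|^{2j} Δʲ P` (for `P` homogeneous of degree
`k`). -/
def harmProj (k : ℕ) (P : Poly) : Poly :=
  ∑ j ∈ range (k / 2 + 1), cP k j • (rsq ^ j * lap^[j] P)

/-- The complementary part `Q_k P = -∑_{j < k/2} c_{j+1} |y|^{2j} Δ^{j+1} P`, so that
`P = Π_k P + |y|² Q_k P`. -/
def fischerRem (k : ℕ) (P : Poly) : Poly :=
  -∑ j ∈ range (k / 2), cP k (j + 1) • (rsq ^ j * lap^[j + 1] P)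

/-- A real multiple of a homogeneous polynomial is homogeneous of the same degree. -/
theorem isHomogeneous_smul {F : Poly} {n : ℕ} (hF : F.IsHomogeneous n) (c : ℝ) :
    (c • F).IsHomogeneous n := by
  rw [smul_eq_C_mul]
  simpa using (isHomogeneous_C (Fin 3) c).mul hF

/-- `|y|^{2j} Δⁱ P` is homogeneous of degree `2j + (k - 2i)`. -/
theorem isHomogeneous_rsq_pow_mul_lap_iterate {P : Poly} {k : ℕ} (hP : P.IsHomogeneous k)
    (j i : ℕ) : (rsq ^ j * lap^[i] P).IsHomogeneous (2 * j + (k - 2 * i)) := by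
  have := (rsq_isHomogeneous.pow j).mul (isHomogeneous_lap_iterate hP i)
  simpa [mul_comm] using this

/-- `Π_k P` is homogeneous of degree `k`. -/
theorem harmProj_isHomogeneous {P : Poly} {k : ℕ} (hP : P.IsHomogeneous k) :
    (harmProj k P).IsHomogeneous k := by
  unfold harmProj
  refine IsHomogeneous.sum _ _ _ fun j hj => isHomogeneous_smul ?_ _
  have hj' : 2 * j ≤ k := by have := Finset.mem_range.1 hj; omega
  have h := isHomogeneous_rsq_pow_mul_lap_iterate hP j j
  have e : 2 * j + (k - 2 * j) = k := by omega
  rwa [e] at h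

/-- `Q_k P` is homogeneous of degree `k - 2`. -/
theorem fischerRem_isHomogeneous {P : Poly} {k : ℕ} (hP : P.IsHomogeneous k) :
    (fischerRem k P).IsHomogeneous (k - 2) := by
  unfold fischerRem
  refine (IsHomogeneous.sum _ _ _ fun j hj => isHomogeneous_smul ?_ _).neg
  have hj' : 2 * j + 2 ≤ k := by have := Finset.mem_range.1 hj; omega
  have h := isHomogeneous_rsq_pow_mul_lap_iterate hP j (j + 1)
  have e : 2 * j + (k - 2 * (j + 1)) = k - 2 := by omega
  rwa [e] at h

/-- **The harmonic projection is harmonic**: `Δ(Π_k P) = 0` for `P` homogeneous of degree `k`. -/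
theorem lap_harmProj {P : Poly} {k : ℕ} (hP : P.IsHomogeneous k) : lap (harmProj k P) = 0 := by
  set J := k / 2 with hJ
  -- `L i = Δⁱ P`, `T j = |y|^{2j} Δ^{j+1} P`
  set L : ℕ → Poly := fun i => lap^[i] P with hL
  set T : ℕ → Poly := fun j => rsq ^ j * L (j + 1) with hT
  have hLsucc : ∀ i, lap (L i) = L (i + 1) := fun i => by
    simp only [hL, Function.iterate_succ_apply']
  -- `Δ(|y|^{2(j+1)} L_{j+1}) = a_j T_j + |y|² T_{j+1}`
  have hstep : ∀ j, lap (rsq ^ (j + 1) * L (j + 1)) =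
      aCoef j (k - 2 * (j + 1)) • T j + rsq ^ (j + 1) * L (j + 2) := by
    intro j
    rw [lap_rsq_pow_succ_mul' (isHomogeneous_lap_iterate hP (j + 1)), hLsucc]
    rfl
  have hlast : T J = 0 := by
    simp only [hT, hL]
    rw [lap_iterate_eq_zero hP (by omega), mul_zero]
  unfold harmProj
  rw [map_sum]
  simp only [map_smul]
  rw [Finset.sum_range_succ']
  simp only [pow_zero, one_mul, Function.iterate_zero, id_eq, cP]
  change ∑ j ∈ range J, cP k (j + 1) • lap (rsq ^ (j + 1) * L (j + 1)) + (1 : ℝ) • lap (L 0) = 0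
  simp only [hstep, smul_add, Finset.sum_add_distrib, one_smul, hLsucc, smul_smul]
  -- regroup: `∑_{j<J} c_{j+1} • |y|^{2(j+1)} L_{j+2} + L_1 = ∑_{j<J+1} c_j • T_j = ∑_{j<J} c_j • T_j`
  have hre : ∑ j ∈ range J, cP k (j + 1) • (rsq ^ (j + 1) * L (j + 2)) + L (0 + 1) =
      ∑ j ∈ range J, cP k j • T j := by
    have h1 : ∑ j ∈ range (J + 1), cP k j • T j =
        ∑ j ∈ range J, cP k (j + 1) • (rsq ^ (j + 1) * L (j + 2)) + L (0 + 1) := by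
      rw [Finset.sum_range_succ']
      simp [hT, cP]
    rw [← h1, Finset.sum_range_succ, hlast, smul_zero, add_zero]
  rw [add_assoc, hre, ← Finset.sum_add_distrib]
  refine Finset.sum_eq_zero fun j _ => ?_
  rw [← add_smul, cP_succ_mul_aCoef, zero_smul]

/-- **`P = Π_k P + |y|² Q_k P`** for every `P` (no homogeneity needed for this identity). -/
theorem harmProj_add_rsq_mul (k : ℕ) (P : Poly) : harmProj k P + rsq * fischerRem k P = P := by
  unfold harmProj fischerRem
  rcases Nat.eq_zero_or_pos (k / 2) with h0 | hpos
  · rw [h0]; simp [cP]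
  · obtain ⟨J, hJ⟩ : ∃ J, k / 2 = J + 1 := ⟨k / 2 - 1, by omega⟩
    rw [hJ, Finset.sum_range_succ', mul_neg, Finset.mul_sum]
    simp only [pow_zero, one_mul, Function.iterate_zero, id_eq, cP, one_smul, pow_succ',
      mul_smul_comm, mul_assoc]
    abel

/-! ## Powers of linear forms -/

/-- The linear form `L_ξ = ∑ᵢ ξᵢ Xᵢ`. -/
def linForm (ξ : Fin 3 → ℝ) : Poly := ∑ i : Fin 3, C (ξ i) * X i

/-- `L_ξ` is homogeneous of degree `1`. -/
theorem linForm_isHomogeneous (ξ : Fin 3 → ℝ) : (linForm ξ).IsHomogeneous 1 := by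
  unfold linForm
  refine IsHomogeneous.sum _ _ _ fun i _ => ?_
  simpa using (isHomogeneous_C (Fin 3) (ξ i)).mul (isHomogeneous_X ℝ i)

/-- `∂ᵢ L_ξ = ξᵢ`. -/
theorem pderiv_linForm (ξ : Fin 3 → ℝ) (i : Fin 3) : pderiv i (linForm ξ) = C (ξ i) := by
  classical
  unfold linForm
  rw [map_sum]
  have : ∀ j : Fin 3, pderiv i (C (ξ j) * (X j : Poly)) = if j = i then C (ξ i) else 0 := by
    intro j
    rw [pderiv_C_mul, pderiv_X]
    by_cases h : j = i
    · subst h; simp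
    · simp [h]
  simp only [this, Finset.sum_ite_eq', Finset.mem_univ, if_true]

end Summit.CriticalPhenomena.Ising3DConformalLimit.Theorems.HarmonicMomentsIsotropy.Fischer

end
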